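import Literature.NumberTheory.Transcendental.MasserThmIArith
import Literature.NumberTheory.Transcendental.MasserThmIAnalytic
import Literature.NumberTheory.Transcendental.MasserThmIExtrapolation
import HarnessLib

/-!
# Masser 1975, Theorem I — the endgame (§1.3: Lemmas 1.8, 1.10, 1.11 assembled)

Support for the proof of Theorem I (a transcendence measure for `τ = ω₂/ω₁`) of D. W. Masser,
*Elliptic Functions and Transcendence*, LNM 437 (1975), Ch. I §1.3, on the book's own line towards
Theorem II (`Literature.NumberTheory.Transcendental.masser_ellipticPeriods`).

This file assembles the contradiction of §1.3 from the pieces proved in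
`MasserThmIArith.lean` (Siegel step, Liouville steps, comparison (10)),
`MasserThmIAnalytic.lean` (the entire function `G = σ^{2L}σ^{2L}Φ`, growth, `σ`-bounds, Cauchy),
`MasserThmIExtrapolation.lean` (maximum modulus with approximate zeros at the points `s + ¼`) and
`MasserXiSet.lean` (Lemma 1.5), GIVEN a choice of the parameters `k, L (= n), h, k₁, h₁` satisfying
finitely many explicit numerical inequalities (`Run.Hyp`): `Run.contradiction`. The existence of
such parameters for `H ≥ H₀(ε)` (the book's `k = [(log H)^{2+40δ}]`, `L = [k^{½+δ}]`,
`h = [k^{½-2δ}]`, `k₁ = [k^{1+6δ}]`, `h₁ = [k^{½+2δ}]`) and the statement of Theorem I are the sequel.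

Everything here is proved; no named facts.

## References

* D. W. Masser, *Elliptic Functions and Transcendence*, Lecture Notes in Math. 437, Springer 1975,
  Ch. I §1.3 (pp. 5–10). [Masser1975]
-/

noncomputable section

open Complex Metric Set Filter Finset NumberField
open _root_.Topology
open scoped PeriodPair

namespace Literature.NumberTheory.Transcendental.Masser1975

/-! ### The constants of the lattice -/

/-- The constants of the proof of Theorem I that depend only on the lattice: the disc `𝒟`
(Lemma 1.1), the growth constant of `G` (Lemma 1.9), the `σ`-bounds on `ξ`, the Cauchy constant
of the multiplier, and the constants of Lemma 1.5. [cite: Masser1975, §1.3 ("c, c₁, … depending only on ω₁, ω₂, d and ε")] -/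
structure Consts (L : PeriodPair) where
  /-- Lemma 1.1 -/
  d : DiscData L
  /-- growth of `G` -/
  CG : ℝ
  hCG0 : 0 ≤ CG
  hCG : ∀ (n : ℕ) (p : ℕ → ℕ → ℂ) (z : ℂ),
    ‖Gfun L n p z‖ ≤ coeffSum n p * Real.exp (CG * (n + 1) * (1 + ‖z‖ ^ 2))
  /-- `σ`-lower bound on `ξ` -/
  cσ : ℝ
  /-- `σ`-lower bound on `ξ` -/
  Cσ : ℝ
  hcσ : 0 < cσ
  hCσ : 0 ≤ Cσ
  hΦ : ∀ (n : ℕ) (p : ℕ → ℕ → ℂ), ∀ z ∈ xiSet d,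
    ‖biEval L n p z‖ ≤ ‖Gfun L n p z‖ * (cσ⁻¹ * Real.exp (Cσ * (1 + ‖z‖ ^ 2))) ^ (4 * n)
  /-- Cauchy for the multiplier -/
  Cu : ℝ
  hCu0 : 0 ≤ Cu
  hCu : ∀ (n i : ℕ) (c : ℂ), ‖iteratedDeriv i (sigmaMult L n) c‖ ≤
    i.factorial * Real.exp (Cu * (n + 1) * (1 + (‖c‖ + 1) ^ 2))
  /-- Lemma 1.5 -/
  N₀ : ℕ
  /-- Lemma 1.5 -/
  C₁₀ : ℕ
  /-- Lemma 1.5 -/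
  κ : ℝ
  /-- Lemma 1.5 -/
  R : ℝ
  hN₀ : 1 ≤ N₀
  hC₁₀ : 1 ≤ C₁₀
  hκ : 0 < κ
  hR : 0 < R
  h15 : ∀ n : ℕ, N₀ ≤ n → ∀ (p : ℕ → ℕ → ℂ) (M μ : ℝ), 0 < μ →
    (∀ v : ℤ × ℤ × ℤ, v ≠ 0 → |v.1| ≤ C₁₀ * n → |v.2.1| ≤ C₁₀ * n → |v.2.2| ≤ C₁₀ * n →
      μ ≤ ‖periodForm L v‖) →
    (∀ z ∈ xiSet d, ‖z‖ ≤ R * n → ‖biEval L n p z‖ ≤ M) →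
    ∀ i j : ℕ, i ≤ n → j ≤ n → ‖p i j‖ ≤ (κ * (n : ℝ) ^ 2 / μ) ^ n * M

/-- The constants exist. [folklore] -/
theorem exists_consts (L : PeriodPair) : Nonempty (Consts L) := by
  obtain ⟨d⟩ := exists_discData L
  obtain ⟨CG, hCG0, hCG⟩ := norm_Gfun_le L
  obtain ⟨cσ, hcσ, Cσ, hCσ, hΦ⟩ := norm_biEval_le_of_mem_xiSet d
  obtain ⟨Cu, hCu0, hCu⟩ := norm_iteratedDeriv_sigmaMult_le L
  obtain ⟨N₀, C₁₀, κ, R, hN₀, hκ, hR, h15⟩ := masser_lemma_1_5 d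
  -- enlarge `C₁₀` to `max C₁₀ 1` (the hypothesis of Lemma 1.5 only gets stronger)
  refine ⟨⟨d, CG, hCG0, hCG, cσ, Cσ, hcσ, hCσ, hΦ, Cu, hCu0, hCu, N₀, max C₁₀ 1, κ, R, hN₀,
    le_max_right _ _, hκ, hR, fun n hn p M μ hμ hmin hM => h15 n hn p M μ hμ (fun v hv h1 h2 h3 =>
      hmin v hv (h1.trans ?_) (h2.trans ?_) (h3.trans ?_)) hM⟩⟩ <;>
    exact_mod_cast Nat.mul_le_mul_right n (le_max_left C₁₀ 1)

/-! ### The parameters and the explicit quantities -/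

/-- The data of one run of the argument of §1.3: the lattice data `S`, the quadratic `Q`
(`α = β/C` of exact height `H`), the constants, the smallness `E` with `|τ - α| < E ≤ 1`, and the
integer parameters `k, n (= L), h, k₁, h₁`. [cite: Masser1975, §1.3] -/
structure Run where
  /-- the lattice with algebraic invariants -/
  S : TSetup
  /-- the quadratic -/
  Q : QData
  /-- the constants of the lattice -/
  K : Consts S.L
  /-- the smallness -/
  E : ℝ
  /-- Masser's `k` -/
  k : ℕ
  /-- Masser's `L` -/
  n : ℕ
  /-- Masser's `h` -/
  h : ℕ
  /-- Masser's `k₁` -/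
  k₁ : ℕ
  /-- Masser's `h₁` -/
  h₁ : ℕ

namespace Run

variable (P : Run)

/-- `τ = ω₂/ω₁`. [folklore] -/
def τ : ℂ := P.S.L.ω₂ / P.S.L.ω₁

/-- `T = |τ| + 1` (bounds `|τ|` and `|α|`). [folklore] -/
def T : ℝ := ‖P.τ‖ + 1

/-- `T₁ = max(1, |ω₁|)`. [folklore] -/
def T₁ : ℝ := max 1 ‖P.S.L.ω₁‖

/-- `T₀ = max(1, |ω₁|⁻¹)`. [folklore] -/
def T₀ : ℝ := max 1 ‖P.S.L.ω₁‖⁻¹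

/-- The coefficient bound `Pc = (n+1)² · Pb(n, k)` (`∑ |p| ≤ Pc`). [folklore] -/
def Pc : ℝ := (((P.n + 1) ^ 2 : ℕ) : ℝ) * P.S.Pb P.Q P.n P.k

/-- Step 1 smallness `η₁ = 2^k e^{Cu(n+1)(1+(h+3)²)} T₁^k Pc D(n,k) E`. [cite: Masser1975, Lemma 1.10 (proof, (13))] -/
def η₁ : ℝ := 2 ^ P.k * Real.exp (P.K.Cu * (P.n + 1) * (1 + ((P.h : ℝ) + 3) ^ 2)) *
  (P.T₁ ^ P.k * (P.Pc * Dcomp P.S P.T P.n P.k * P.E))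

/-- Step 1 growth `Θ₁ = Pc e^{CG(n+1)(1+(5(h+1))²)}`. [cite: Masser1975, Lemma 1.10 (proof)] -/
def Θ₁ : ℝ := P.Pc * Real.exp (P.K.CG * (P.n + 1) * (1 + (5 * ((P.h : ℝ) + 1)) ^ 2))

/-- Step 1 output `G₁ = η₁ Ξ + (Θ₁ + η₁ Ξ)(5/6)^{(k+1)h}`, `Ξ = Ξ(h, k+1)`. [cite: Masser1975, Lemma 1.10 (proof)] -/
def G₁ : ℝ := P.η₁ * xiFactor P.h (P.k + 1) + (P.Θ₁ + P.η₁ * xiFactor P.h (P.k + 1)) *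
  (5 / 6 : ℝ) ^ ((P.k + 1) * P.h)

/-- The bound for `|Φ|` on `∂𝒟`: `B₁ = G₁ (cσ⁻¹ e^{2Cσ})^{4n}`. [cite: Masser1975, Lemma 1.10 (proof, "|P(ζ)| > 1")] -/
def B₁ : ℝ := P.G₁ * (P.K.cσ⁻¹ * Real.exp (P.K.Cσ * 2)) ^ (4 * P.n)

/-- The bound for `|A_m(α)|`, `m ≤ k₁`: `U = T₀^{k₁} k₁! ρ^{-k₁} B₁ + Pc D(n,k₁) E`. [cite: Masser1975, Lemma 1.10 (proof, "|A_m| < exp(-c₁₉hk)")] -/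
def U : ℝ := P.T₀ ^ P.k₁ * (P.k₁.factorial * P.B₁ / P.K.d.ρ ^ P.k₁) +
  P.Pc * Dcomp P.S P.T P.n P.k₁ * P.E

/-- The conjugate bound `Bc = (n+1)² Pb Amat(n,k₁)` for the numbers `E_ν(m)`. [cite: Masser1975, Lemma 1.10 (proof, "size at most H^{c₂₁k₁}")] -/
def Bc : ℝ := (((P.n + 1) ^ 2 : ℕ) : ℝ) * P.S.Pb P.Q P.n P.k * P.S.Amat P.Q P.n P.k₁

/-- The Liouville threshold `Λ₁ = ((3H²Bc⁴)^{h-1} 4H Bc²)⁻¹`. [cite: Masser1975, Lemma 1.10 (proof, "|A_m| > H^{-c₂₂k₁}")] -/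
def Λ₁ : ℝ := ((3 * (P.Q.H : ℝ) ^ 2 * P.Bc ^ 2 * P.Bc ^ 2) ^ (P.S.G.h - 1) *
  (4 * P.Q.H * P.Bc * P.Bc))⁻¹

/-- Step 2 smallness `η₂`. [cite: Masser1975, Lemma 1.11 (proof)] -/
def η₂ : ℝ := 2 ^ P.k₁ * Real.exp (P.K.Cu * (P.n + 1) * (1 + ((P.h₁ : ℝ) + 3) ^ 2)) *
  (P.T₁ ^ P.k₁ * (P.Pc * Dcomp P.S P.T P.n P.k₁ * P.E))

/-- Step 2 growth `Θ₂`. [cite: Masser1975, Lemma 1.11 (proof)] -/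
def Θ₂ : ℝ := P.Pc * Real.exp (P.K.CG * (P.n + 1) * (1 + (5 * ((P.h₁ : ℝ) + 1)) ^ 2))

/-- Step 2 output `G₂`. [cite: Masser1975, Lemma 1.11 (proof)] -/
def G₂ : ℝ := P.η₂ * xiFactor P.h₁ (P.k₁ + 1) + (P.Θ₂ + P.η₂ * xiFactor P.h₁ (P.k₁ + 1)) *
  (5 / 6 : ℝ) ^ ((P.k₁ + 1) * P.h₁)

/-- The bound `MΦ = G₂ (cσ⁻¹ e^{Cσ(1+(Rn)²)})^{4n}` for `|Φ|` on `ξ ∩ {|z| ≤ Rn}` (Lemma 1.11).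
[cite: Masser1975, Lemma 1.11] -/
def MΦ : ℝ := P.G₂ * (P.K.cσ⁻¹ * Real.exp (P.K.Cσ * (1 + (P.K.R * P.n) ^ 2))) ^ (4 * P.n)

/-- The lower bound `μ = |ω₁|² (18 C₁₀ n H⁴)⁻¹` for `|Aω₁² + Bω₁ω₂ + Cω₂²|`. [cite: Masser1975, §1.3 (end, "μ > H^{-c₂₉}")] -/
def μ : ℝ := ‖P.S.L.ω₁‖ ^ 2 * (18 * (P.K.C₁₀ : ℝ) * P.n * (P.Q.H : ℝ) ^ 4)⁻¹

/-- **The hypotheses of one run**: `|τ - α| < E ≤ 1`, the exact height, and the finitely many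
numerical inequalities between the explicit quantities that the proof of §1.3 consumes (they hold
for Masser's choice of parameters once `H ≥ H₀(ε)`). [cite: Masser1975, §1.3] -/
structure Hyp : Prop where
  hdisc : P.Q.B ^ 2 - 4 * P.Q.A * P.Q.C < 0
  hmin : ∀ A' B' C' : ℤ, (A', B', C') ≠ (0, 0, 0) →
    (A' : ℂ) + (B' : ℂ) * P.Q.α + (C' : ℂ) * P.Q.α ^ 2 = 0 → (P.Q.H : ℤ) ≤ max |A'| (max |B'| |C'|)
  hE0 : 0 < P.E
  hE1 : P.E ≤ 1
  hclose : ‖P.τ - P.Q.α‖ < P.E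
  hk : 1 ≤ P.k
  hkk₁ : P.k ≤ P.k₁
  hn : P.K.N₀ ≤ P.n
  hh : 1 ≤ P.h
  hh₁ : 1 ≤ P.h₁
  hsiegel : 4 * (P.k + 1) ≤ (P.n + 1) ^ 2
  hP1 : P.K.R * P.n ≤ (P.h₁ : ℝ) + 1
  hP3 : ((P.K.C₁₀ * P.n : ℕ) : ℤ) < P.Q.H
  hBc : 1 ≤ P.Bc
  hL1 : (|(P.S.d : ℝ)|) ^ (2 * P.n + P.k₁) * (P.Q.H : ℝ) ^ P.k₁ * P.U < P.Λ₁
  hP4 : 3 * (P.K.C₁₀ : ℝ) * P.n * P.T * P.E ≤ (18 * (P.K.C₁₀ : ℝ) * P.n * (P.Q.H : ℝ) ^ 4)⁻¹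
  hF : (P.K.κ * (P.n : ℝ) ^ 2 / P.μ) ^ P.n * P.MΦ < (P.S.Pb P.Q P.n P.k ^ (P.S.G.h - 1))⁻¹

end Run

/-! ### Monotonicity of `D(n, m)` in `m` -/

/-- `D(n, m) ≤ D(n, m')` for `m ≤ m'` (`T ≥ 1`). [folklore] -/
theorem Dcomp_mono (S : TSetup) {T : ℝ} (hT : 1 ≤ T) (n : ℕ) {m m' : ℕ} (hmm : m ≤ m') :
    Dcomp S T n m ≤ Dcomp S T n m' := by
  unfold Dcomp
  have hM := S.G.one_le_M
  have hM0 : 0 ≤ S.G.M := zero_le_one.trans hM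
  have hT0 : 0 ≤ T := zero_le_one.trans hT
  have hmm' : (m : ℝ) ≤ m' := by exact_mod_cast hmm
  have hb : (1 : ℝ) ≤ 7 * ((2 * n + m + 1 : ℕ) : ℝ) := by
    have : (1 : ℝ) ≤ ((2 * n + m + 1 : ℕ) : ℝ) := by exact_mod_cast (by omega : 1 ≤ 2 * n + m + 1)
    linarith
  have hbb : 7 * ((2 * n + m + 1 : ℕ) : ℝ) ≤ 7 * ((2 * n + m' + 1 : ℕ) : ℝ) := by
    have : ((2 * n + m + 1 : ℕ) : ℝ) ≤ ((2 * n + m' + 1 : ℕ) : ℝ) := by exact_mod_cast (by omega : 2 * n + m + 1 ≤ 2 * n + m' + 1)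
    linarith
  have h1 : (m : ℝ) + 1 ≤ m' + 1 := by linarith
  have h2 : (2 : ℝ) ^ m ≤ 2 ^ m' := pow_le_pow_right₀ (by norm_num) hmm
  have h3 : T ^ m ≤ T ^ m' := pow_le_pow_right₀ hT hmm
  have h4 : (7 * ((2 * n + m + 1 : ℕ) : ℝ)) ^ (2 * m) ≤ (7 * ((2 * n + m' + 1 : ℕ) : ℝ)) ^ (2 * m') :=
    (pow_le_pow_left₀ (by positivity) hbb _).trans (pow_le_pow_right₀ (hb.trans hbb) (by omega))
  have h5 : S.G.M ^ (2 * (n + m)) ≤ S.G.M ^ (2 * (n + m')) := pow_le_pow_right₀ hM (by omega)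
  have hA : ((m : ℝ) + 1) * 2 ^ m * m * T ^ m ≤ ((m' : ℝ) + 1) * 2 ^ m' * m' * T ^ m' := by
    have := mul_le_mul (mul_le_mul (mul_le_mul h1 h2 (by positivity) (by positivity)) hmm'
      (Nat.cast_nonneg m) (by positivity)) h3 (pow_nonneg hT0 m) (by positivity)
    exact this
  exact mul_le_mul (mul_le_mul hA h4 (by positivity) (by positivity)) h5 (pow_nonneg hM0 _)
    (by positivity)

namespace Run

variable (P : Run)

/-! ### Elementary facts -/

/-- `1 ≤ T`. [folklore] -/
theorem one_le_T : 1 ≤ P.T := by unfold T; have := norm_nonneg P.τ; linarith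

/-- `‖τ‖ ≤ T`. [folklore] -/
theorem norm_τ_le : ‖P.τ‖ ≤ P.T := by unfold T; linarith

/-- `‖α‖ ≤ T` when `|τ - α| < E ≤ 1`. [folklore] -/
theorem norm_α_le (hP : P.Hyp) : ‖P.Q.α‖ ≤ P.T := by
  have h1 : ‖P.Q.α‖ ≤ ‖P.τ‖ + ‖P.τ - P.Q.α‖ := by
    calc ‖P.Q.α‖ = ‖P.τ - (P.τ - P.Q.α)‖ := by ring_nf
      _ ≤ ‖P.τ‖ + ‖P.τ - P.Q.α‖ := norm_sub_le _ _
  unfold T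
  linarith [hP.hclose, hP.hE1]

/-- `1 ≤ T₁` and `‖ω₁‖^m ≤ T₁^K` for `m ≤ K`. [folklore] -/
theorem norm_ω₁_pow_le {m K : ℕ} (hm : m ≤ K) : ‖P.S.L.ω₁‖ ^ m ≤ P.T₁ ^ K := by
  have h1 : 1 ≤ P.T₁ := le_max_left _ _
  calc ‖P.S.L.ω₁‖ ^ m ≤ P.T₁ ^ m := pow_le_pow_left₀ (norm_nonneg _) (le_max_right _ _) m
    _ ≤ P.T₁ ^ K := pow_le_pow_right₀ h1 hm

/-- `‖ω₁‖^{-m} ≤ T₀^K` for `m ≤ K`. [folklore] -/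
theorem norm_ω₁_inv_pow_le {m K : ℕ} (hm : m ≤ K) : ‖P.S.L.ω₁‖⁻¹ ^ m ≤ P.T₀ ^ K := by
  have h1 : 1 ≤ P.T₀ := le_max_left _ _
  calc ‖P.S.L.ω₁‖⁻¹ ^ m ≤ P.T₀ ^ m := pow_le_pow_left₀ (by positivity) (le_max_right _ _) m
    _ ≤ P.T₀ ^ K := pow_le_pow_right₀ h1 hm

/-- `1 ≤ H`. [folklore] -/
theorem one_le_H : (1 : ℝ) ≤ P.Q.H := by exact_mod_cast P.Q.one_le_H

/-- `ω₁ ≠ 0`. [folklore] -/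
theorem ω₁_ne_zero : P.S.L.ω₁ ≠ 0 := by simpa using basis_ne_zero P.S.L 0

/-- `0 ≤ Pc`. [folklore] -/
theorem Pc_nonneg : 0 ≤ P.Pc := by
  unfold Pc
  exact mul_nonneg (by positivity) (zero_le_one.trans (P.S.one_le_Pb P.Q P.n P.k))

/-! ### Step A: the derivatives of `Φ` and of `G` at the points `s + ¼` -/

/-- **Derivatives of `Φ` at `s + ¼`**: if `A_m(α) = 0` for `m ≤ K` then for `m ≤ K`,
`‖Φ^{(m)}(s+¼)‖ ≤ T₁^K · Pc · D(n,K) · E` (periodicity, `Φ^{(m)}(¼) = ω₁^m A_m(τ)`, and (10)).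
[cite: Masser1975, §1.3 (proof of Lemma 1.10, (10) and "since Φ has period 1")] -/
theorem norm_iteratedDeriv_biEval_pt_le (hP : P.Hyp) (p : ℕ → ℕ → ℂ)
    (hPc : coeffSum P.n p ≤ P.Pc) {K : ℕ} (hA0 : ∀ m ≤ K, Aval P.S.L P.n p m P.Q.α = 0)
    (s : ℤ) {m : ℕ} (hm : m ≤ K) :
    ‖iteratedDeriv m (biEval P.S.L P.n p) ((s : ℂ) + 1 / 4)‖ ≤
      P.T₁ ^ K * (P.Pc * Dcomp P.S P.T P.n K * P.E) := by
  have hT := P.one_le_T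
  rw [show ((s : ℂ) + 1 / 4) = (1 / 4 : ℂ) + s by ring, iteratedDeriv_biEval_add_intCast,
    iteratedDeriv_biEval_quarter_eq_Aval, norm_mul, norm_pow]
  have hA : Aval P.S.L P.n p m (P.S.L.ω₂ / P.S.L.ω₁) =
      Aval P.S.L P.n p m (P.S.L.ω₂ / P.S.L.ω₁) - Aval P.S.L P.n p m P.Q.α := by
    rw [hA0 m hm, sub_zero]
  rw [hA]
  have h10 := norm_Aval_sub_le P.S P.n m p hT P.norm_τ_le (P.norm_α_le hP)
  change ‖Aval P.S.L P.n p m P.τ - Aval P.S.L P.n p m P.Q.α‖ ≤ _ at h10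
  have hD : Dcomp P.S P.T P.n m ≤ Dcomp P.S P.T P.n K := Dcomp_mono P.S hT P.n hm
  have hD0 : 0 ≤ Dcomp P.S P.T P.n m := Dcomp_nonneg P.S (zero_le_one.trans hT) P.n m
  have hcs0 := coeffSum_nonneg P.n p
  have hT₁0 : 0 ≤ P.T₁ ^ K := pow_nonneg (zero_le_one.trans (le_max_left _ _)) _
  calc ‖P.S.L.ω₁‖ ^ m * ‖Aval P.S.L P.n p m (P.S.L.ω₂ / P.S.L.ω₁) - Aval P.S.L P.n p m P.Q.α‖
      ≤ P.T₁ ^ K * (coeffSum P.n p * Dcomp P.S P.T P.n m * ‖P.τ - P.Q.α‖) :=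
        mul_le_mul (P.norm_ω₁_pow_le hm) h10 (norm_nonneg _) hT₁0
    _ ≤ P.T₁ ^ K * (P.Pc * Dcomp P.S P.T P.n K * P.E) := by
        refine mul_le_mul_of_nonneg_left ?_ hT₁0
        exact mul_le_mul (mul_le_mul hPc hD hD0 P.Pc_nonneg) hP.hclose.le (norm_nonneg _)
          (mul_nonneg P.Pc_nonneg (Dcomp_nonneg P.S (zero_le_one.trans hT) P.n K))

/-- The generic step smallness `η(K, hh) = 2^K e^{Cu(n+1)(1+(hh+3)²)} T₁^K Pc D(n,K) E`.
[cite: Masser1975, §1.3 (proof of Lemma 1.10, (13))] -/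
def ηgen (K hh : ℕ) : ℝ := 2 ^ K * Real.exp (P.K.Cu * (P.n + 1) * (1 + ((hh : ℝ) + 3) ^ 2)) *
  (P.T₁ ^ K * (P.Pc * Dcomp P.S P.T P.n K * P.E))

/-- `0 ≤ ηgen` (given `0 < E`). [folklore] -/
theorem ηgen_nonneg (hP : P.Hyp) (K hh : ℕ) : 0 ≤ P.ηgen K hh := by
  unfold ηgen
  have h1 : 0 ≤ P.T₁ ^ K := pow_nonneg (zero_le_one.trans (le_max_left _ _)) _
  have h2 : 0 ≤ Dcomp P.S P.T P.n K := Dcomp_nonneg P.S (zero_le_one.trans P.one_le_T) P.n K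
  have h3 := P.Pc_nonneg
  have h4 := hP.hE0.le
  positivity

/-- **Derivatives of `G` at the nodes** (Leibniz + Cauchy for the multiplier): if `A_m(α) = 0`
for `m ≤ K` then `‖G^{(m)}(s + ¼)‖ ≤ η(K, hh) · m!` for `s < hh`, `m ≤ K`.
[cite: Masser1975, §1.3 (proof of Lemma 1.10, (13))] -/
theorem norm_iteratedDeriv_Gfun_pt_le (hP : P.Hyp) (p : ℕ → ℕ → ℂ)
    (hPc : coeffSum P.n p ≤ P.Pc) {K : ℕ} (hA0 : ∀ m ≤ K, Aval P.S.L P.n p m P.Q.α = 0)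
    {hh : ℕ} (s : Fin hh) {m : ℕ} (hm : m < K + 1) :
    ‖iteratedDeriv m (Gfun P.S.L P.n p) (quarterNodes hh s)‖ ≤ P.ηgen K hh * m.factorial := by
  have hm' : m ≤ K := Nat.lt_succ_iff.mp hm
  set c : ℂ := quarterNodes hh s with hc
  have hcreg := regular_intCast_add_quarter (L := P.S.L) ((s : ℕ) + 1 : ℕ)
  have hc_eq : c = (((((s : ℕ) + 1 : ℕ) : ℤ) : ℂ) + 1 / 4) := by
    simp only [hc, quarterNodes]; push_cast; ring
  have h1 : P.S.L.ω₁ * c ∉ P.S.L.lattice := by rw [hc_eq]; exact_mod_cast hcreg.1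
  have h2 : P.S.L.ω₂ * c ∉ P.S.L.lattice := by rw [hc_eq]; exact_mod_cast hcreg.2
  have hc_norm : ‖c‖ + 1 ≤ (hh : ℝ) + 3 := by
    have := norm_quarterNodes_le (h := hh) s
    rw [← hc] at this; linarith
  -- the derivative bounds
  set Dη : ℝ := P.T₁ ^ K * (P.Pc * Dcomp P.S P.T P.n K * P.E) with hDη
  have hDη0 : 0 ≤ Dη := by
    rw [hDη]
    have h1 : 0 ≤ P.T₁ ^ K := pow_nonneg (zero_le_one.trans (le_max_left _ _)) _
    have h2 : 0 ≤ Dcomp P.S P.T P.n K := Dcomp_nonneg P.S (zero_le_one.trans P.one_le_T) P.n K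
    have h3 := P.Pc_nonneg
    have h4 := hP.hE0.le
    positivity
  have hΦ : ∀ i ≤ m, ‖iteratedDeriv i (biEval P.S.L P.n p) c‖ ≤ Dη := by
    intro i hi
    rw [hc_eq]
    exact P.norm_iteratedDeriv_biEval_pt_le hP p hPc hA0 _ (hi.trans hm')
  set Eu : ℝ := Real.exp (P.K.Cu * (P.n + 1) * (1 + ((hh : ℝ) + 3) ^ 2)) with hEu
  have hu : ∀ i, ‖iteratedDeriv i (sigmaMult P.S.L P.n) c‖ ≤ i.factorial * Eu := by
    intro i
    refine (P.K.hCu P.n i c).trans (mul_le_mul_of_nonneg_left ?_ (by positivity))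
    rw [hEu]
    apply Real.exp_le_exp.mpr
    have h0 : 0 ≤ P.K.Cu * (P.n + 1) := mul_nonneg P.K.hCu0 (by positivity)
    have : (‖c‖ + 1) ^ 2 ≤ ((hh : ℝ) + 3) ^ 2 := pow_le_pow_left₀ (by positivity) hc_norm 2
    nlinarith
  calc ‖iteratedDeriv m (Gfun P.S.L P.n p) c‖
      ≤ ∑ i ∈ Finset.range (m + 1), (m.choose i : ℝ) * ‖iteratedDeriv i (sigmaMult P.S.L P.n) c‖ *
          ‖iteratedDeriv (m - i) (biEval P.S.L P.n p) c‖ := norm_iteratedDeriv_Gfun_le P.n p h1 h2 m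
    _ ≤ ∑ i ∈ Finset.range (m + 1), (m.choose i : ℝ) * (m.factorial * Eu) * Dη := by
        refine Finset.sum_le_sum fun i hi => ?_
        have hi' : i ≤ m := Nat.lt_succ_iff.mp (Finset.mem_range.mp hi)
        have hfac : (i.factorial : ℝ) ≤ m.factorial := by exact_mod_cast Nat.factorial_le hi'
        refine mul_le_mul (mul_le_mul_of_nonneg_left ((hu i).trans
          (mul_le_mul_of_nonneg_right hfac (by positivity))) (by positivity)) (hΦ _ (Nat.sub_le m i))
          (norm_nonneg _) (by positivity)
    _ = (2 : ℝ) ^ m * (m.factorial * Eu) * Dη := by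
        rw [← Finset.sum_mul, ← Finset.sum_mul]
        congr 2
        have := Nat.sum_range_choose m
        exact_mod_cast this
    _ ≤ (2 : ℝ) ^ K * (m.factorial * Eu) * Dη := by
        have : (2 : ℝ) ^ m ≤ 2 ^ K := pow_le_pow_right₀ (by norm_num) hm'
        gcongr
    _ = P.ηgen K hh * m.factorial := by rw [ηgen, ← hEu, ← hDη]; ring

/-! ### Step B: the extrapolation -/

/-- The generic growth bound `Θ(hh) = Pc e^{CG(n+1)(1+(5(hh+1))²)}` for `G` on `|z| = 5(hh+1)`.
[cite: Masser1975, Lemma 1.9] -/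
def Θgen (hh : ℕ) : ℝ := P.Pc * Real.exp (P.K.CG * (P.n + 1) * (1 + (5 * ((hh : ℝ) + 1)) ^ 2))

/-- The generic extrapolation output. [cite: Masser1975, §1.3 (proof of Lemma 1.10)] -/
def Ggen (K hh : ℕ) : ℝ := P.ηgen K hh * xiFactor hh (K + 1) +
  (P.Θgen hh + P.ηgen K hh * xiFactor hh (K + 1)) * (5 / 6 : ℝ) ^ ((K + 1) * hh)

/-- **Extrapolation**: if `A_m(α) = 0` for `m ≤ K` then `‖G(w)‖ ≤ Ggen(K, hh)` for `|w| ≤ hh + 1`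
(`hh ≥ 1`). [cite: Masser1975, §1.3 (proofs of Lemmas 1.10, 1.11)] -/
theorem norm_Gfun_le_Ggen (hP : P.Hyp) (p : ℕ → ℕ → ℂ) (hPc : coeffSum P.n p ≤ P.Pc) {K : ℕ}
    (hA0 : ∀ m ≤ K, Aval P.S.L P.n p m P.Q.α = 0) {hh : ℕ} (hhh : 1 ≤ hh) {w : ℂ}
    (hw : ‖w‖ ≤ (hh : ℝ) + 1) : ‖Gfun P.S.L P.n p w‖ ≤ P.Ggen K hh := by
  have hΘ0 : 0 ≤ P.Θgen hh := by unfold Θgen; have := P.Pc_nonneg; positivity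
  have hΘ : ∀ z ∈ sphere (0 : ℂ) (5 * ((hh : ℝ) + 1)), ‖Gfun P.S.L P.n p z‖ ≤ P.Θgen hh := by
    intro z hz
    have hzn : ‖z‖ = 5 * ((hh : ℝ) + 1) := mem_sphere_zero_iff_norm.mp hz
    refine (P.K.hCG P.n p z).trans ?_
    unfold Θgen
    rw [hzn]
    exact mul_le_mul_of_nonneg_right hPc (by positivity)
  exact norm_le_of_small_derivs_quarter (differentiable_Gfun P.S.L P.n p) hhh (by omega)
    (P.ηgen_nonneg hP K hh) hΘ0 (fun s j hj => P.norm_iteratedDeriv_Gfun_pt_le hP p hPc hA0 s hj)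
    hΘ hw

/-! ### Step C: Lemma 1.10 — `A_m(α) = 0` up to `k₁` -/

/-- `G₁ = Ggen(k, h)`. [folklore] -/
theorem G₁_eq : P.G₁ = P.Ggen P.k P.h := rfl

/-- On the circle `|z - ¼| = ρ`: `|Φ| ≤ B₁` (from `|G| ≤ G₁` there and the `σ`-lower bound).
[cite: Masser1975, §1.3 (proof of Lemma 1.10, "|P(ζ)| > 1 and … |Φ(ζ)| < exp(-c₁₅hk)")] -/
theorem norm_biEval_sphere_le (hP : P.Hyp) (p : ℕ → ℕ → ℂ) (hPc : coeffSum P.n p ≤ P.Pc)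
    (hA0 : ∀ m ≤ P.k, Aval P.S.L P.n p m P.Q.α = 0) {z : ℂ} (hz : z ∈ sphere (1 / 4 : ℂ) P.K.d.ρ) :
    ‖biEval P.S.L P.n p z‖ ≤ P.B₁ := by
  have hzball : z ∈ closedBall (1 / 4 : ℂ) P.K.d.ρ := sphere_subset_closedBall hz
  have hzξ : z ∈ xiSet P.K.d := fun i => ⟨0, P.S.L.lattice.zero_mem, by simpa using hzball⟩
  have hzn : ‖z‖ ≤ 1 := by
    have h1 : ‖z - 1 / 4‖ ≤ P.K.d.ρ := mem_closedBall_iff_norm.mp hzball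
    have hρ := P.K.d.ρ_le
    calc ‖z‖ = ‖(z - 1 / 4) + 1 / 4‖ := by ring_nf
      _ ≤ ‖z - 1 / 4‖ + ‖(1 / 4 : ℂ)‖ := norm_add_le _ _
      _ ≤ P.K.d.ρ + 1 / 4 := by rw [show ‖(1 / 4 : ℂ)‖ = 1 / 4 by norm_num]; linarith
      _ ≤ 1 := by linarith
  have hG : ‖Gfun P.S.L P.n p z‖ ≤ P.G₁ := by
    rw [G₁_eq]
    exact P.norm_Gfun_le_Ggen hP p hPc hA0 hP.hh (hzn.trans (by
      have : (1 : ℝ) ≤ P.h := by exact_mod_cast hP.hh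
      linarith))
  refine (P.K.hΦ P.n p z hzξ).trans ?_
  unfold B₁
  have hG0 : 0 ≤ P.G₁ := (norm_nonneg _).trans hG
  refine mul_le_mul hG (pow_le_pow_left₀ (by have := P.K.hcσ; positivity) ?_ _) (by
    have := P.K.hcσ; positivity) hG0
  refine mul_le_mul_of_nonneg_left (Real.exp_le_exp.mpr ?_) (by have := P.K.hcσ; positivity)
  have : ‖z‖ ^ 2 ≤ 1 := by nlinarith [norm_nonneg z]
  nlinarith [P.K.hCσ]

/-- **Lemma 1.10**: `A_m(α) = 0` for all `m ≤ k₁` (otherwise `|d^{2n+k₁} C^m A_m(α)| < Λ₁`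
contradicts the Liouville bound `quad_liouville`). [cite: Masser1975, Lemma 1.10] -/
theorem Aval_α_eq_zero_upto_k₁ (hP : P.Hyp) {ξ : Fin (P.n + 1) × Fin (P.n + 1) → 𝓞 P.S.K}
    (hPb : ∀ ij, house ((ξ ij : 𝓞 P.S.K) : P.S.K) ≤ P.S.Pb P.Q P.n P.k)
    (hA0 : ∀ m ≤ P.k, Aval P.S.L P.n (P.S.pFun ξ) m P.Q.α = 0) (hPc : coeffSum P.n (P.S.pFun ξ) ≤ P.Pc)
    {m : ℕ} (hm : m ≤ P.k₁) : Aval P.S.L P.n (P.S.pFun ξ) m P.Q.α = 0 := by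
  set p := P.S.pFun ξ with hp
  by_contra hne
  -- the upper bound `|A_m(α)| ≤ U`
  have hT := P.one_le_T
  have hB : ∀ z ∈ sphere (1 / 4 : ℂ) P.K.d.ρ, ‖biEval P.S.L P.n p z‖ ≤ P.B₁ := fun z hz =>
    P.norm_biEval_sphere_le hP p hPc hA0 hz
  have hcauchy := norm_iteratedDeriv_biEval_quarter_le P.K.d P.n p hB m
  have hΦm : ‖iteratedDeriv m (biEval P.S.L P.n p) (1 / 4)‖ = ‖P.S.L.ω₁‖ ^ m *
      ‖Aval P.S.L P.n p m P.τ‖ := by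
    rw [iteratedDeriv_biEval_quarter_eq_Aval, norm_mul, norm_pow]; rfl
  have hω : 0 < ‖P.S.L.ω₁‖ := norm_pos_iff.mpr P.ω₁_ne_zero
  have hpt : ((1 / 4 : ℂ) + (P.K.d.ρ : ℂ)) ∈ sphere (1 / 4 : ℂ) P.K.d.ρ := by
    rw [mem_sphere_iff_norm, add_sub_cancel_left, Complex.norm_real, Real.norm_eq_abs,
      abs_of_pos P.K.d.ρ_pos]
  have hB₁0 : 0 ≤ P.B₁ := (norm_nonneg _).trans (hB _ hpt)
  have hAτ : ‖Aval P.S.L P.n p m P.τ‖ ≤ P.T₀ ^ P.k₁ * (P.k₁.factorial * P.B₁ / P.K.d.ρ ^ P.k₁) := by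
    have h1 : ‖Aval P.S.L P.n p m P.τ‖ = ‖P.S.L.ω₁‖⁻¹ ^ m * ‖iteratedDeriv m (biEval P.S.L P.n p) (1 / 4)‖ := by
      rw [hΦm, ← mul_assoc, ← mul_pow, inv_mul_cancel₀ hω.ne', one_pow, one_mul]
    rw [h1]
    have hρ := P.K.d.ρ_pos
    have hρ1 : P.K.d.ρ ≤ 1 := P.K.d.ρ_le.trans (by norm_num)
    have h2 : (m.factorial : ℝ) * P.B₁ / P.K.d.ρ ^ m ≤ P.k₁.factorial * P.B₁ / P.K.d.ρ ^ P.k₁ := by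
      have hf : (m.factorial : ℝ) ≤ P.k₁.factorial := by exact_mod_cast Nat.factorial_le hm
      have hρpow : P.K.d.ρ ^ P.k₁ ≤ P.K.d.ρ ^ m := pow_le_pow_of_le_one hρ.le hρ1 hm
      rw [div_le_div_iff₀ (pow_pos hρ _) (pow_pos hρ _)]
      exact mul_le_mul (mul_le_mul hf le_rfl hB₁0 (by positivity)) hρpow (pow_nonneg hρ.le _)
        (mul_nonneg (by positivity) hB₁0)
    exact mul_le_mul (P.norm_ω₁_inv_pow_le hm) (hcauchy.trans h2) (norm_nonneg _)
      (pow_nonneg (zero_le_one.trans (le_max_left _ _)) _)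
  have h10 : ‖Aval P.S.L P.n p m P.τ - Aval P.S.L P.n p m P.Q.α‖ ≤ P.Pc * Dcomp P.S P.T P.n P.k₁ * P.E := by
    refine (norm_Aval_sub_le P.S P.n m p hT P.norm_τ_le (P.norm_α_le hP)).trans ?_
    have hD := Dcomp_mono P.S hT P.n hm
    have hD0 : 0 ≤ Dcomp P.S P.T P.n m := Dcomp_nonneg P.S (zero_le_one.trans hT) P.n m
    exact mul_le_mul (mul_le_mul hPc hD hD0 P.Pc_nonneg) hP.hclose.le (norm_nonneg _)
      (mul_nonneg P.Pc_nonneg (Dcomp_nonneg P.S (zero_le_one.trans hT) P.n _))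
  have hU : ‖Aval P.S.L P.n p m P.Q.α‖ ≤ P.U := by
    calc ‖Aval P.S.L P.n p m P.Q.α‖ = ‖Aval P.S.L P.n p m P.τ - (Aval P.S.L P.n p m P.τ - Aval P.S.L P.n p m P.Q.α)‖ := by ring_nf
      _ ≤ ‖Aval P.S.L P.n p m P.τ‖ + ‖Aval P.S.L P.n p m P.τ - Aval P.S.L P.n p m P.Q.α‖ := norm_sub_le _ _
      _ ≤ P.U := add_le_add hAτ h10
  -- the algebraic integer `Z = d^{2n+k₁} C^m A_m(α) = x₀ + β x₁`
  have hPb1 := P.S.one_le_Pb P.Q P.n P.k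
  obtain ⟨x₀, hx₀, hx₀c⟩ := P.S.exists_E P.Q ξ hPb1 hPb 0 hm
  obtain ⟨x₁, hx₁, hx₁c⟩ := P.S.exists_E P.Q ξ hPb1 hPb 1 hm
  have hZ : ((x₀ : P.S.K) : ℂ) + P.Q.β * ((x₁ : P.S.K) : ℂ) =
      (P.S.d : ℂ) ^ (2 * P.n + P.k₁) * ((P.Q.C : ℂ) ^ m * Aval P.S.L P.n p m P.Q.α) := by
    rw [hx₀, hx₁, Cpow_mul_Aval_eq]; ring
  have hd0 : (P.S.d : ℂ) ≠ 0 := by exact_mod_cast P.S.G.den_ne_zero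
  have hC0 : (P.Q.C : ℂ) ≠ 0 := by exact_mod_cast P.Q.hC0
  have hZne : ((x₀ : P.S.K) : ℂ) + P.Q.β * ((x₁ : P.S.K) : ℂ) ≠ 0 := by
    rw [hZ]
    exact mul_ne_zero (pow_ne_zero _ hd0) (mul_ne_zero (pow_ne_zero _ hC0) hne)
  have hconj₀ : ∀ σ : P.S.K →+* ℂ, ‖σ (x₀ : P.S.K)‖ ≤ P.Bc := fun σ => by
    have := hx₀c σ; unfold Bc; exact this
  have hconj₁ : ∀ σ : P.S.K →+* ℂ, ‖σ (x₁ : P.S.K)‖ ≤ P.Bc := fun σ => by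
    have := hx₁c σ; unfold Bc; exact this
  have hliou := P.S.quad_liouville P.Q hP.hdisc.ne hP.hBc hP.hBc hconj₀ hconj₁ hZne
  -- but `|Z| ≤ |d|^{2n+k₁} H^{k₁} U < Λ₁`
  have hupper : ‖((x₀ : P.S.K) : ℂ) + P.Q.β * ((x₁ : P.S.K) : ℂ)‖ ≤
      (|(P.S.d : ℝ)|) ^ (2 * P.n + P.k₁) * (P.Q.H : ℝ) ^ P.k₁ * P.U := by
    rw [hZ, norm_mul, norm_mul, norm_pow, norm_pow, Complex.norm_intCast, Complex.norm_intCast]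
    have hCH : |(P.Q.C : ℝ)| ^ m ≤ (P.Q.H : ℝ) ^ P.k₁ := by
      calc |(P.Q.C : ℝ)| ^ m ≤ (P.Q.H : ℝ) ^ m := pow_le_pow_left₀ (abs_nonneg _) (by exact_mod_cast P.Q.hC) m
        _ ≤ (P.Q.H : ℝ) ^ P.k₁ := pow_le_pow_right₀ P.one_le_H hm
    rw [mul_assoc]
    refine mul_le_mul_of_nonneg_left (mul_le_mul hCH hU (norm_nonneg _) (by positivity)) (by positivity)
  have : P.Λ₁ ≤ (|(P.S.d : ℝ)|) ^ (2 * P.n + P.k₁) * (P.Q.H : ℝ) ^ P.k₁ * P.U := by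
    unfold Λ₁; exact hliou.trans hupper
  exact absurd hP.hL1 (not_lt.mpr this)

/-! ### Step D: Lemma 1.11 — `Φ` is small on `ξ` -/

/-- `G₂ = Ggen(k₁, h₁)`. [folklore] -/
theorem G₂_eq : P.G₂ = P.Ggen P.k₁ P.h₁ := rfl

/-- **Lemma 1.11**: `‖Φ(ζ)‖ ≤ MΦ` for `ζ ∈ ξ`, `|ζ| ≤ R n`. [cite: Masser1975, Lemma 1.11] -/
theorem norm_biEval_le_MΦ (hP : P.Hyp) (p : ℕ → ℕ → ℂ) (hPc : coeffSum P.n p ≤ P.Pc)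
    (hA0 : ∀ m ≤ P.k₁, Aval P.S.L P.n p m P.Q.α = 0) {ζ : ℂ} (hζ : ζ ∈ xiSet P.K.d)
    (hζn : ‖ζ‖ ≤ P.K.R * P.n) : ‖biEval P.S.L P.n p ζ‖ ≤ P.MΦ := by
  have hG : ‖Gfun P.S.L P.n p ζ‖ ≤ P.G₂ := by
    rw [G₂_eq]
    exact P.norm_Gfun_le_Ggen hP p hPc hA0 hP.hh₁ (hζn.trans hP.hP1)
  refine (P.K.hΦ P.n p ζ hζ).trans ?_
  unfold MΦ
  have hG0 : 0 ≤ P.G₂ := (norm_nonneg _).trans hG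
  have hc := P.K.hcσ
  refine mul_le_mul hG (pow_le_pow_left₀ (by positivity) ?_ _) (by positivity) hG0
  refine mul_le_mul_of_nonneg_left (Real.exp_le_exp.mpr ?_) (by positivity)
  have hR0 := P.K.hR.le
  have : ‖ζ‖ ^ 2 ≤ (P.K.R * P.n) ^ 2 := pow_le_pow_left₀ (norm_nonneg _) hζn 2
  nlinarith [P.K.hCσ]

/-! ### Step E: the lower bound `μ` -/

/-- **`μ` is admissible**: `μ ≤ |A'ω₁² + B'ω₁ω₂ + C'ω₂²|` for all integer `(A',B',C') ≠ 0` with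
`|A'|,|B'|,|C'| ≤ C₁₀ n` (`σ = A' + B'α + C'α² ≠ 0` by the exact height, `|σ| ≥ (9C₁₀nH⁴)⁻¹`,
`|A' + B'τ + C'τ² - σ| ≤ 3C₁₀nT E`). [cite: Masser1975, §1.3 (end of the proof of Thm I)] -/
theorem μ_le_periodForm (hP : P.Hyp) (v : ℤ × ℤ × ℤ) (hv : v ≠ 0)
    (h1 : |v.1| ≤ P.K.C₁₀ * P.n) (h2 : |v.2.1| ≤ P.K.C₁₀ * P.n) (h3 : |v.2.2| ≤ P.K.C₁₀ * P.n) :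
    P.μ ≤ ‖periodForm P.S.L v‖ := by
  obtain ⟨A', B', C'⟩ := v
  simp only at h1 h2 h3
  set X : ℕ := P.K.C₁₀ * P.n with hX
  have hω := P.ω₁_ne_zero
  -- `periodForm = ω₁² (A' + B'τ + C'τ²)`
  have hform : periodForm P.S.L (A', B', C') = P.S.L.ω₁ ^ 2 *
      ((A' : ℂ) + (B' : ℂ) * P.τ + (C' : ℂ) * P.τ ^ 2) := by
    unfold periodForm Run.τ
    field_simp
  -- `σ ≠ 0`
  have hvne : ((A', B', C') : ℤ × ℤ × ℤ) ≠ (0, 0, 0) := hv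
  have hX1 : 1 ≤ X := by
    by_contra h0
    push Not at h0
    have hX0 : X = 0 := by omega
    have hz : (P.K.C₁₀ : ℤ) * (P.n : ℤ) = 0 := by
      have : ((P.K.C₁₀ * P.n : ℕ) : ℤ) = 0 := by rw [← hX, hX0]; rfl
      push_cast at this
      exact this
    rw [hz] at h1 h2 h3
    have hA : A' = 0 := abs_nonpos_iff.mp h1
    have hB : B' = 0 := abs_nonpos_iff.mp h2
    have hC : C' = 0 := abs_nonpos_iff.mp h3
    exact hvne (by rw [hA, hB, hC])
  have hσne : (A' : ℂ) + (B' : ℂ) * P.Q.α + (C' : ℂ) * P.Q.α ^ 2 ≠ 0 := by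
    intro h0
    have hle := hP.hmin A' B' C' hvne h0
    have hmax : max |A'| (max |B'| |C'|) ≤ (X : ℤ) := max_le h1 (max_le h2 h3)
    have := hP.hP3
    rw [← hX] at this
    omega
  have hσ := P.Q.norm_quadForm_α_ge hP.hdisc.ne hX1 h1 h2 h3 hσne
  -- the perturbation
  have hT := P.one_le_T
  have hpert : ‖((A' : ℂ) + (B' : ℂ) * P.τ + (C' : ℂ) * P.τ ^ 2) -
      ((A' : ℂ) + (B' : ℂ) * P.Q.α + (C' : ℂ) * P.Q.α ^ 2)‖ ≤ 3 * (X : ℝ) * P.T * P.E := by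
    have hsub : ((A' : ℂ) + (B' : ℂ) * P.τ + (C' : ℂ) * P.τ ^ 2) -
        ((A' : ℂ) + (B' : ℂ) * P.Q.α + (C' : ℂ) * P.Q.α ^ 2) =
        (P.τ - P.Q.α) * ((B' : ℂ) + (C' : ℂ) * (P.τ + P.Q.α)) := by ring
    rw [hsub, norm_mul]
    have hB'r : ‖(B' : ℂ)‖ ≤ X := by rw [Complex.norm_intCast]; exact_mod_cast h2
    have hC'r : ‖(C' : ℂ)‖ ≤ X := by rw [Complex.norm_intCast]; exact_mod_cast h3
    have hτα : ‖P.τ + P.Q.α‖ ≤ 2 * P.T := by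
      calc ‖P.τ + P.Q.α‖ ≤ ‖P.τ‖ + ‖P.Q.α‖ := norm_add_le _ _
        _ ≤ P.T + P.T := add_le_add P.norm_τ_le (P.norm_α_le hP)
        _ = 2 * P.T := by ring
    have hsec : ‖(B' : ℂ) + (C' : ℂ) * (P.τ + P.Q.α)‖ ≤ 3 * X * P.T := by
      calc ‖(B' : ℂ) + (C' : ℂ) * (P.τ + P.Q.α)‖ ≤ ‖(B' : ℂ)‖ + ‖(C' : ℂ)‖ * ‖P.τ + P.Q.α‖ := by
            rw [← norm_mul]; exact norm_add_le _ _
        _ ≤ X + X * (2 * P.T) := by gcongr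
        _ ≤ 3 * X * P.T := by
            have : (0 : ℝ) ≤ X := Nat.cast_nonneg X
            nlinarith
    calc ‖P.τ - P.Q.α‖ * ‖(B' : ℂ) + (C' : ℂ) * (P.τ + P.Q.α)‖ ≤ P.E * (3 * X * P.T) :=
          mul_le_mul hP.hclose.le hsec (norm_nonneg _) hP.hE0.le
      _ = 3 * (X : ℝ) * P.T * P.E := by ring
  have e1 : (X : ℝ) = (P.K.C₁₀ : ℝ) * P.n := by rw [hX]; push_cast; ring
  have hP4 : 3 * (X : ℝ) * P.T * P.E ≤ (18 * (X : ℝ) * (P.Q.H : ℝ) ^ 4)⁻¹ := by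
    rw [e1, show 3 * ((P.K.C₁₀ : ℝ) * P.n) * P.T * P.E = 3 * (P.K.C₁₀ : ℝ) * P.n * P.T * P.E by ring,
      show 18 * ((P.K.C₁₀ : ℝ) * P.n) * (P.Q.H : ℝ) ^ 4 = 18 * (P.K.C₁₀ : ℝ) * P.n * (P.Q.H : ℝ) ^ 4 by ring]
    exact hP.hP4
  -- conclude
  have hmain : (18 * (X : ℝ) * (P.Q.H : ℝ) ^ 4)⁻¹ ≤ ‖(A' : ℂ) + (B' : ℂ) * P.τ + (C' : ℂ) * P.τ ^ 2‖ := by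
    have htri : ‖(A' : ℂ) + (B' : ℂ) * P.Q.α + (C' : ℂ) * P.Q.α ^ 2‖ -
        ‖((A' : ℂ) + (B' : ℂ) * P.τ + (C' : ℂ) * P.τ ^ 2) -
          ((A' : ℂ) + (B' : ℂ) * P.Q.α + (C' : ℂ) * P.Q.α ^ 2)‖ ≤
        ‖(A' : ℂ) + (B' : ℂ) * P.τ + (C' : ℂ) * P.τ ^ 2‖ := by
      have := norm_sub_norm_le ((A' : ℂ) + (B' : ℂ) * P.Q.α + (C' : ℂ) * P.Q.α ^ 2)
        ((A' : ℂ) + (B' : ℂ) * P.τ + (C' : ℂ) * P.τ ^ 2)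
      rw [norm_sub_rev] at this
      linarith
    have hHX : (0 : ℝ) < 18 * (X : ℝ) * (P.Q.H : ℝ) ^ 4 := by
      have : (1 : ℝ) ≤ X := by exact_mod_cast hX1
      have := P.one_le_H
      positivity
    have hinv : (18 * (X : ℝ) * (P.Q.H : ℝ) ^ 4)⁻¹ = (9 * (X : ℝ) * (P.Q.H : ℝ) ^ 4)⁻¹ - (18 * (X : ℝ) * (P.Q.H : ℝ) ^ 4)⁻¹ := by
      field_simp; ring
    rw [hinv]
    linarith
  rw [hform, norm_mul, norm_pow]
  unfold μ
  rw [e1] at hmain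
  refine mul_le_mul_of_nonneg_left ?_ (by positivity)
  rw [show 18 * (P.K.C₁₀ : ℝ) * P.n * (P.Q.H : ℝ) ^ 4 = 18 * ((P.K.C₁₀ : ℝ) * P.n) * (P.Q.H : ℝ) ^ 4 by ring]
  exact hmain

/-- `0 < μ`. [folklore] -/
theorem μ_pos (hP : P.Hyp) : 0 < P.μ := by
  unfold μ
  have hω : 0 < ‖P.S.L.ω₁‖ := norm_pos_iff.mpr P.ω₁_ne_zero
  have hn : (1 : ℝ) ≤ P.n := by exact_mod_cast P.K.hN₀.trans hP.hn
  have hC : (1 : ℝ) ≤ P.K.C₁₀ := by exact_mod_cast P.K.hC₁₀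
  have hH := P.one_le_H
  positivity

end Run


namespace Run

variable (P : Run)

/-! ### The contradiction -/

/-- **The argument of §1.3 closes**: under the hypotheses `Hyp` (in particular `|τ - α| < E`)
one gets `False` — Siegel (Lemma 1.8), Lemma 1.10, Lemma 1.11, the admissible `μ`, Lemma 1.5, and
the Liouville bound for a non-zero coefficient `p(λ₁,λ₂)`. [cite: Masser1975, §1.3 (proof of Thm I, pp. 9–10)] -/
theorem contradiction (hP : P.Hyp) : False := by
  obtain ⟨ξ, hξ0, hMξ, hhouse⟩ := P.S.exists_solution P.Q (n := P.n) (k := P.k) hP.hsiegel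
  set p : ℕ → ℕ → ℂ := P.S.pFun ξ with hp
  have hA0k : ∀ m ≤ P.k, Aval P.S.L P.n p m P.Q.α = 0 := fun m hm =>
    P.S.Aval_α_eq_zero_of_mulVec P.Q hMξ hm
  have hPb1 := P.S.one_le_Pb P.Q P.n P.k
  have hpB : ∀ i j, ‖p i j‖ ≤ P.S.Pb P.Q P.n P.k := fun i j =>
    P.S.norm_pFun_le ξ (zero_le_one.trans hPb1) hhouse i j
  have hPc : coeffSum P.n p ≤ P.Pc := by
    unfold coeffSum Pc
    calc ∑ i ∈ Finset.range (P.n + 1), ∑ j ∈ Finset.range (P.n + 1), ‖p i j‖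
        ≤ ∑ _i ∈ Finset.range (P.n + 1), ∑ _j ∈ Finset.range (P.n + 1), P.S.Pb P.Q P.n P.k :=
          Finset.sum_le_sum fun i _ => Finset.sum_le_sum fun j _ => hpB i j
      _ = (((P.n + 1) ^ 2 : ℕ) : ℝ) * P.S.Pb P.Q P.n P.k := by
          rw [Finset.sum_const, Finset.card_range, Finset.sum_const, Finset.card_range, nsmul_eq_mul,
            nsmul_eq_mul]
          push_cast; ring
  -- Lemma 1.10
  have hA0 : ∀ m ≤ P.k₁, Aval P.S.L P.n p m P.Q.α = 0 := fun m hm =>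
    P.Aval_α_eq_zero_upto_k₁ hP hhouse hA0k hPc hm
  -- Lemma 1.11 and Lemma 1.5
  have hM : ∀ z ∈ xiSet P.K.d, ‖z‖ ≤ P.K.R * P.n → ‖biEval P.S.L P.n p z‖ ≤ P.MΦ :=
    fun z hz hzn => P.norm_biEval_le_MΦ hP p hPc hA0 hz hzn
  have hμ := P.μ_pos hP
  have h15 := P.K.h15 P.n hP.hn p P.MΦ P.μ hμ
    (fun v hv h1 h2 h3 => P.μ_le_periodForm hP v hv h1 h2 h3) hM
  -- a non-zero coefficient and its Liouville bound
  obtain ⟨ij, hij⟩ : ∃ ij, ξ ij ≠ 0 := by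
    by_contra h
    push Not at h
    exact hξ0 (funext h)
  have hlow := P.S.norm_pFun_ge ξ hPb1 hhouse ij hij
  have hup := h15 ij.1 ij.2 (Nat.lt_succ_iff.mp ij.1.isLt) (Nat.lt_succ_iff.mp ij.2.isLt)
  have hF := hP.hF
  change (P.S.Pb P.Q P.n P.k ^ (P.S.G.h - 1))⁻¹ ≤ ‖p ij.1 ij.2‖ at hlow
  linarith

end Run

end Literature.NumberTheory.Transcendental.Masser1975
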